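import Summits.QuantumFields.YangMills.Theorems.UnitScaleTiltProp7SectET3CurvedPropagatorsT3
import Summits.QuantumFields.YangMills.Theorems.UnitScaleTiltProp7SectET3WilsonHessianT3
import HarnessLib

/-!
# Route `UnitScaleTilt`, crux «MinimiserStabilityRegPr» (stmt-QuantumFields-19200, stub EX) ∕ (O″χ) B0 (stmt-QuantumFields-20520), node N06(d = 3), route (α) —
# DEFINITIONS FILE, LAYER 0 BRICK L0b PART 2: **`Δ′_a = Δ^η_U + Q′*aQ′` (3.24), `G′ = (Δ′_a)⁻¹` (3.25), THE GAUGE-INVARIANT EXTENSION `Δ_π` (3.119) AT A T³ MEMBER, AND — BY NAME — PRINT'S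
# `G = (Δ_π + DRD* + Q*aQ)⁻¹` (3.122) AND `H = GQ*(QGQ*)⁻¹` (3.126) ON THE ROUTE CARRIERS** = the (46)-twˢ supplier of record of the EX knit's `h46tw` (★★OWNER ym3-torus-plan g26 RULINGS
# №10 ADDENDUM ∕ №12 (3) ∕ ACK 32 (q2)), as the instances `Δx := DeltaPi` of brick L0d's total letters

Cell `ym-inputs` (desk `pub/ym-inputs`, INPUT-LIST.md v6 §4 row p01 = I-06 B0 DEFINER LEAD, layer 0 = the (L2)∕(L4)∕(L6) DEFINITION programme of WANTED №g25-1; memo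
`pub/ym-inputs/DEFINER-MEMO-T3.md` §2; seat `ym-inputs-p01`).  YM₃ on T³ is ladder rung R3, NOT the Clay problem; nothing here is a claim about a stub, a crux, d = 4 or the mass gap.
`--supports stmt-QuantumFields-20520` (B0 of (O″χ) needs N06(d = 3), RULING g26-№2 (4)); count-neutral; review lane (definitions + `dif`∕`rfl` glue only).

THE PRINT.  [Balaban1985BackgroundPropagators] p. 394: *«Δ′_a = Δ′_a(U) = (Δ^η_U + Q′*aQ′)↾Ω₀, where Q′*aQ′ is defined by the same quadratic form as in (2.14) … (3.24) … Its inverse is denoted by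
G′, or G′(U)»*; p. 395: *«Assuming some regularity of the configuration U it can be easily shown that the operator Δ′_a is positive. This implies positivity of the operators G′ …»*;
p. 419 (3.118)–(3.119): *«We define a new quadratic form extending ⟨A, ΔA⟩ in a gauge invariant way to all configurations A … ⟨A, Δ_πA⟩ = ⟨A − DG′RD*A, Δ(A − DG′RD*A)⟩. (3.119) The
quadratic form is invariant with respect to gauge transformations determined by λ ∈ N(Q′) … the expression A − DG′RD*A has this invariance property. It is obtained by gauge transforming an
arbitrary configuration A to the subspace {A : RD*A = 0}»*; p. 420 (3.122) *«G⁻¹ = Δ_π + DRD* + Q*aQ»*, (3.126) *«HB = GQ*(QGQ*)⁻¹B»*; Thm 3.11 p. 416 (positivity of `Δ′_a`, `G′`, `Δ_a`, `G` on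
the regular class).  [Balaban1985Variational] (45)–(46) p. 285 (the `H` of the chart (47)).

WHY ∕ HOW (rulings ACK 32 (q1)–(q2)).  With the INTRINSIC residual gauge algebra of brick L0c (`Q′ := QDS = Q∘D`, `N_S = ker QDS`, `R_S`), print's scalar operator (3.24) is
`laplacePrimeA := Δ^η_{U₀} + a·QDS†QDS` on the weighted `L²` space of the gauge parameters, `G′` its inverse ON THE CLASS where it is positive definite (Thm 3.11 — displayed) and `0` off it,
and (3.119) is the operator `Δ_π := Pᵀ Δ P`, `P := 1 − D G′ R_S D*` (the «gauge transformation to the subspace {RD*A = 0}»), `Δ` = brick L0b's `DeltaEta` ((3.12), the v1.1 letter of record), adjoint in brick L0a's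
pairing.  Feeding `Δx := DeltaPi` to brick L0d's total letters gives — by name — print's `G` (3.122), `(QGQ*)⁻¹`, `H` (3.126) and the (115)∕route-carrier readers; in particular
**`H46 … U₀ := Hf … (DeltaPi …) U₀`** is the letter `H` of the EX binder `h46tw` (`Prop7StubEXOfChartPiecesTwL.lean:151`, type `(PBond (F.P n) 0 → M₂) →ₗ[ℂ] (PBond (F.P K) 0 → M₂)`)
AS THE SUPPLIER OF RECORD NAMES IT; its (45)₁ row is ✓`QTwS_Hf`, its Landau member and its size (46) are rows ∕ N06.

WHAT IS DEFINED (member `F`, `h : n ≤ K`, parameters `c₀ cB a`, background `U₀`): **`laplacePrimeA … U₀`** ((3.24)), the class **`PosPrime … U₀`** (`0 < re⟨λ, Δ′_aλ⟩`, `λ ≠ 0`),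
**`GprimeT … U₀ := if h : PosPrime then greenK _ h else 0`** ((3.25) `G′`), **`gaugeCorr … U₀ := 1 − DL2 ∘ G′ ∘ R_S ∘ DstarL2`** ((3.119)'s `A ↦ A − DG′RD*A`), **`DeltaPi … U₀ := gaugeCorr† ∘ Δ ∘ gaugeCorr`**
((3.119)), the L0d slot **`DeltaPiSlot … : ∀ U₀, BondL2K →ₗ[ℂ] BondL2K`**, and the named instances **`Gpi`** (print's `G` (3.122) = `GT … DeltaPiSlot`), **`Hpi`** (print's `H` (3.126), Hilbert level =
`HT … DeltaPiSlot`), **`H46`** (the `h46tw` letter = `Hf … DeltaPiSlot`).  Glue: `GprimeT_of_pos∕_of_not`, `laplacePrimeA_GprimeT` (`Δ′_aG′ = 1` on the class), `gaugeCorr_apply`, `DeltaPi_apply`, `inner_DeltaPi` ((3.119) as a form),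
`DeltaPiSlot_apply`; the (45)₁ row for `H46` is ✓`QTwS_Hf` (brick L0e part 1) at `Δx := DeltaPiSlot`, by `exact`.
HONEST SCOPE.  Definitions; positivity of `Δ′_a`∕`Δ_a` NOT proved (classes `PosPrime`, `PosOnto`; Thm 3.11 on the regular class is the N06 input); the gauge INVARIANCE of `Δ_π` on `N_S`
((3.119)'s sentence; needs `R_S D*Dλ = D*Dλ` ✓`RS_apply_covLapSite_of_mem` + `G′Δ^η λ = λ − …`) and (3.124) are rows (L0e part 2); `Δ₁` (3.128) for `G₁`∕`H₁`∕`𝔊` is NOT this letter (later brick);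
nothing of print asserted; not a proof of any stub; nothing continuum ∕ OS ∕ mass-gap ∕ Clay.

References: T. Bałaban, CMP **99** (1985) 389–434 [Balaban1985BackgroundPropagators] ((3.24)–(3.25) p.394, p.395, Thm 3.11 p.416, (3.118)–(3.126) pp.419–420); CMP **102** (1985) 277–309
[Balaban1985Variational] ((45)–(47) p.285).
-/

set_option autoImplicit false

noncomputable section

open scoped InnerProductSpace ComplexConjugate Matrix.Norms.L2Operator BigOperators

namespace Summit.QuantumFields.YangMills.Theorems.Prop7SectET3DeltaPi

open Literature.MathematicalPhysics.QuantumFieldTheory.Balaban1983to89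
open Literature.MathematicalPhysics.QuantumFieldTheory.Balaban1983to89.T3ContinuumYM3Torus
open T3SectALandauChart (eta)
open B9SectCLatticeCarrier (Bond)
open B9Eq311L2Pairing (WL2)
open B11Eq103H1Complex (SiteL2K BondL2K greenK apply_greenK)
open Summit.QuantumFields.YangMills.Theorems.Prop7SectET3Transport (periodsT3)
open Summit.QuantumFields.YangMills.Theorems.Prop7SectET3HilbertLetters (W₂ toL2 toL2B DL2 DstarL2 covLapSite)
open Summit.QuantumFields.YangMills.Theorems.Prop7SectET3GaugeProjector (QDS RS)
open Summit.QuantumFields.YangMills.Theorems.Prop7SectET3CurvedPropagators (PosOnto GT KinvT HT Hf)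
open Summit.QuantumFields.YangMills.Theorems.Prop7SectET3WilsonHessian (DeltaEta)

variable (F : T3Family) (n K : ℕ) (h : n ≤ K) (c₀ cB a : ℝ) [Fact (0 < c₀)] [Fact (0 < cB)]

/-! ## §1 `Δ′_a` (3.24), its class, `G′` (3.25) -/

/-- **(3.24) `Δ′_a(U₀) = Δ^η_{U₀} + a·Q′*Q′` ON THE GAUGE PARAMETERS** with the intrinsic `Q′ := Q(U₀)∘D_{U₀}` of brick L0c (ACK 32 (q1)); `Q′* :=` the Hilbert adjoint in the weighted `L²` spaces.
[cite: Balaban1985BackgroundPropagators, (3.24) p.394] -/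
def laplacePrimeA (U₀ : GaugeField (F.P K) 0 (Matrix.specialUnitaryGroup (Fin 2) ℂ)) : SiteL2K ℂ 3 (periodsT3 F K) c₀ W₂ →ₗ[ℂ] SiteL2K ℂ 3 (periodsT3 F K) c₀ W₂ :=
  covLapSite F n K c₀ U₀ + ((a : ℂ)) • (LinearMap.adjoint (QDS F n K h c₀ cB U₀) ∘ₗ QDS F n K h c₀ cB U₀)

/-- **THE CLASS «`Δ′_a(U₀)` positive definite»** (p. 395 «Assuming some regularity of the configuration U it can be easily shown that the operator Δ′_a is positive»; Thm 3.11) — displayed,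
not proved. [cite: Balaban1985BackgroundPropagators, Thm 3.11 p.416] -/
structure PosPrime (U₀ : GaugeField (F.P K) 0 (Matrix.specialUnitaryGroup (Fin 2) ℂ)) : Prop where
  /-- `0 < re⟨λ, Δ′_aλ⟩` for `λ ≠ 0`. -/
  pos : ∀ x : SiteL2K ℂ 3 (periodsT3 F K) c₀ W₂, x ≠ 0 → 0 < RCLike.re ⟪x, laplacePrimeA F n K h c₀ cB a U₀ x⟫_ℂ

open Classical in
/-- **(3.25) `G′(U₀) = (Δ′_a)⁻¹` AS A TOTAL LETTER**: lit-balaban's `greenK` on the class `PosPrime`, `0` off it. [cite: Balaban1985BackgroundPropagators, (3.25) p.394] -/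
def GprimeT (U₀ : GaugeField (F.P K) 0 (Matrix.specialUnitaryGroup (Fin 2) ℂ)) : SiteL2K ℂ 3 (periodsT3 F K) c₀ W₂ →ₗ[ℂ] SiteL2K ℂ 3 (periodsT3 F K) c₀ W₂ :=
  if hp : PosPrime F n K h c₀ cB a U₀ then greenK (laplacePrimeA F n K h c₀ cB a U₀) hp.pos else 0

/-! ## §2 `Δ_π` (3.119) and the slot for brick L0d -/

/-- **THE «GAUGE TRANSFORMATION TO THE SUBSPACE {RD*A = 0}» `A ↦ A − DG′R_SD*A`** of (3.119). [cite: Balaban1985BackgroundPropagators, (3.119) p.419] -/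
def gaugeCorr (U₀ : GaugeField (F.P K) 0 (Matrix.specialUnitaryGroup (Fin 2) ℂ)) : BondL2K ℂ 3 (periodsT3 F K) c₀ W₂ →ₗ[ℂ] BondL2K ℂ 3 (periodsT3 F K) c₀ W₂ :=
  LinearMap.id - DL2 F n K c₀ U₀ ∘ₗ GprimeT F n K h c₀ cB a U₀ ∘ₗ RS F n K h c₀ cB U₀ ∘ₗ DstarL2 F n K c₀ U₀

/-- **(3.119) `Δ_π(U₀) := Pᵀ Δ^η(U₀) P`, `P = 1 − DG′R_SD*`** — the operator of the quadratic form `⟨A − DG′RD*A, Δ(A − DG′RD*A)⟩` in brick L0a's pairing (`Δ^η` = brick L0b's `DeltaEta`).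
[cite: Balaban1985BackgroundPropagators, (3.118)–(3.120) p.419] -/
def DeltaPi (U₀ : GaugeField (F.P K) 0 (Matrix.specialUnitaryGroup (Fin 2) ℂ)) : BondL2K ℂ 3 (periodsT3 F K) c₀ W₂ →ₗ[ℂ] BondL2K ℂ 3 (periodsT3 F K) c₀ W₂ :=
  LinearMap.adjoint (gaugeCorr F n K h c₀ cB a U₀) ∘ₗ (DeltaEta F n K c₀ U₀ : BondL2K ℂ 3 (periodsT3 F K) c₀ W₂ →ₗ[ℂ] BondL2K ℂ 3 (periodsT3 F K) c₀ W₂) ∘ₗ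
    gaugeCorr F n K h c₀ cB a U₀

/-- **THE `Δx` SLOT OF BRICK L0d FILLED WITH `Δ_π`** (so that L0d's `laplaceA … DeltaPiSlot U₀ = Δ_π + DR_SD* + Q*aQ = G⁻¹` of (3.122)). [cite: Balaban1985BackgroundPropagators, (3.122) p.420] -/
def DeltaPiSlot : GaugeField (F.P K) 0 (Matrix.specialUnitaryGroup (Fin 2) ℂ) → (BondL2K ℂ 3 (periodsT3 F K) c₀ W₂ →ₗ[ℂ] BondL2K ℂ 3 (periodsT3 F K) c₀ W₂) :=
  fun U₀ => DeltaPi F n K h c₀ cB a U₀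

/-! ## §3 Print's `G`, `H` of (3.122)∕(3.126) BY NAME, and the `h46tw` letter -/

/-- **PRINT'S `G(U₀) = (Δ_π + DRD* + Q*aQ)⁻¹` (3.122) AT THE MEMBER** (total: lit-balaban's `G1LatticeK` on the class `PosOnto … DeltaPiSlot U₀`, `0` off it).
[cite: Balaban1985BackgroundPropagators, (3.122) p.420] -/
abbrev Gpi (U₀ : GaugeField (F.P K) 0 (Matrix.specialUnitaryGroup (Fin 2) ℂ)) : BondL2K ℂ 3 (periodsT3 F K) c₀ W₂ →ₗ[ℂ] BondL2K ℂ 3 (periodsT3 F K) c₀ W₂ :=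
  GT F n K h c₀ cB a (DeltaPiSlot F n K h c₀ cB a) U₀

/-- **PRINT'S `H(U₀) = GQ*(QGQ*)⁻¹` (3.126) AT THE MEMBER, Hilbert level** (block fields → vector fields). [cite: Balaban1985BackgroundPropagators, (3.126) p.420] -/
abbrev Hpi (U₀ : GaugeField (F.P K) 0 (Matrix.specialUnitaryGroup (Fin 2) ℂ)) : WL2 ℂ (fun _ : PBond (F.P n) 0 => cB) W₂ →ₗ[ℂ] BondL2K ℂ 3 (periodsT3 F K) c₀ W₂ :=
  HT F n K h c₀ cB a (DeltaPiSlot F n K h c₀ cB a) U₀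

/-- **THE LETTER `H` OF THE EX BINDER `h46tw` — ITS SUPPLIER OF RECORD** (RULINGS g26-№10 ADDENDUM∕№12 (3): print's `H(U₀) = GQ*(QGQ*)⁻¹` on `Q := QTwS`, exponent scale): `Hf` of brick L0d at
`Δx := DeltaPiSlot`, type `(PBond (F.P n) 0 → M₂(ℂ)) →ₗ[ℂ] (PBond (F.P K) 0 → M₂(ℂ))`. [cite: Balaban1985Variational, (45)–(46) p.285; Balaban1985BackgroundPropagators, (3.126) p.420] -/
abbrev H46 (U₀ : GaugeField (F.P K) 0 (Matrix.specialUnitaryGroup (Fin 2) ℂ)) : (PBond (F.P n) 0 → Matrix (Fin 2) (Fin 2) ℂ) →ₗ[ℂ] (PBond (F.P K) 0 → Matrix (Fin 2) (Fin 2) ℂ) :=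
  Hf F n K h c₀ cB a (DeltaPiSlot F n K h c₀ cB a) U₀

/-! ## §4 Glue -/

variable {F n K h c₀ cB a}

/-- On the class, `G′` IS lit-balaban's `greenK`. [cite: Balaban1985BackgroundPropagators, (3.25) p.394] -/
theorem GprimeT_of_pos {U₀ : GaugeField (F.P K) 0 (Matrix.specialUnitaryGroup (Fin 2) ℂ)} (hp : PosPrime F n K h c₀ cB a U₀) :
    GprimeT F n K h c₀ cB a U₀ = greenK (laplacePrimeA F n K h c₀ cB a U₀) hp.pos := dif_pos hp

/-- Off the class, `G′ = 0` (junk). [folklore] -/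
theorem GprimeT_of_not {U₀ : GaugeField (F.P K) 0 (Matrix.specialUnitaryGroup (Fin 2) ℂ)} (hp : ¬ PosPrime F n K h c₀ cB a U₀) : GprimeT F n K h c₀ cB a U₀ = 0 := dif_neg hp

/-- **`Δ′_a G′ = 1` ON THE CLASS.** [cite: Balaban1985BackgroundPropagators, (3.25) p.394] -/
theorem laplacePrimeA_GprimeT {U₀ : GaugeField (F.P K) 0 (Matrix.specialUnitaryGroup (Fin 2) ℂ)} (hp : PosPrime F n K h c₀ cB a U₀) (x : SiteL2K ℂ 3 (periodsT3 F K) c₀ W₂) :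
    laplacePrimeA F n K h c₀ cB a U₀ (GprimeT F n K h c₀ cB a U₀ x) = x := by
  rw [GprimeT_of_pos hp]
  exact apply_greenK hp.pos x

/-- Unfolding `P = 1 − DG′R_SD*`. [cite: Balaban1985BackgroundPropagators, (3.119) p.419] -/
theorem gaugeCorr_apply (U₀ : GaugeField (F.P K) 0 (Matrix.specialUnitaryGroup (Fin 2) ℂ)) (A : BondL2K ℂ 3 (periodsT3 F K) c₀ W₂) :
    gaugeCorr F n K h c₀ cB a U₀ A = A - DL2 F n K c₀ U₀ (GprimeT F n K h c₀ cB a U₀ (RS F n K h c₀ cB U₀ (DstarL2 F n K c₀ U₀ A))) := rfl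

/-- Unfolding `Δ_π = Pᵀ Δ P`. [cite: Balaban1985BackgroundPropagators, (3.119) p.419] -/
theorem DeltaPi_apply (U₀ : GaugeField (F.P K) 0 (Matrix.specialUnitaryGroup (Fin 2) ℂ)) (A : BondL2K ℂ 3 (periodsT3 F K) c₀ W₂) :
    DeltaPi F n K h c₀ cB a U₀ A = LinearMap.adjoint (gaugeCorr F n K h c₀ cB a U₀) (DeltaEta F n K c₀ U₀ (gaugeCorr F n K h c₀ cB a U₀ A)) := rfl

/-- **(3.119) AS A FORM: `⟪A′, Δ_π A⟫ = ⟪P A′, Δ (P A)⟫`** — «⟨A, Δ_πA⟩ = ⟨A − DG′RD*A, Δ(A − DG′RD*A)⟩». [cite: Balaban1985BackgroundPropagators, (3.119) p.419] -/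
theorem inner_DeltaPi (U₀ : GaugeField (F.P K) 0 (Matrix.specialUnitaryGroup (Fin 2) ℂ)) (A' A : BondL2K ℂ 3 (periodsT3 F K) c₀ W₂) :
    ⟪A', DeltaPi F n K h c₀ cB a U₀ A⟫_ℂ = ⟪gaugeCorr F n K h c₀ cB a U₀ A', DeltaEta F n K c₀ U₀ (gaugeCorr F n K h c₀ cB a U₀ A)⟫_ℂ := by
  rw [DeltaPi_apply, LinearMap.adjoint_inner_right]

/-- Unfolding the slot. [cite: Balaban1985BackgroundPropagators, (3.122) p.420] -/
theorem DeltaPiSlot_apply (U₀ : GaugeField (F.P K) 0 (Matrix.specialUnitaryGroup (Fin 2) ℂ)) : DeltaPiSlot F n K h c₀ cB a U₀ = DeltaPi F n K h c₀ cB a U₀ := rfl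

end Summit.QuantumFields.YangMills.Theorems.Prop7SectET3DeltaPi

end
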